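import Summits.Langlands.Langlands.Theses.IrreducibilityBySelfDuality
import Summits.Langlands.Langlands.Theorems.IrreducibilityBySelfDualityReciprocityUpToIrreducibility
import Summits.Langlands.Langlands.Theorems.IrreducibilityBySelfDualityReciprocityUpToIrreducibilityRankOne
import Summits.Langlands.Langlands.Theorems.IrreducibilityBySelfDualityIrreducibleOffSectorTransfer
import Literature.FieldTheory.AlgClosed.PadicAlgClEquivComplex
import Literature.NumberTheory.PAdicHodge.FontaineDpst
import Literature.NumberTheory.GaloisRepresentations.LocalGaloisGroupProofs
import Literature.NumberTheory.GaloisRepresentations.LocalGaloisGroupFrobeniusProofs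

/-!
# Disproof work file — crux `ReciprocityUpToIrreducibility` (stmt-Langlands-14328)

(cdisprove seat refuter-cdisprove-stmt-Langlands-14328-0, cycle 1.)  VERDICT: **no kill** — the crux is
consistent open mathematics; but it is **formally undecidable in the present tree** (§C), which is the
negative knowledge this file and its landed companions record.  LANDED under
`Summits/Langlands/Langlands/Theorems/ReciprocityUpToIrreducibility/Negative/`: `FontaineSpecUnramifiedTwist`
(§A, p100453 ACCEPTED), `TrivialCharacterLocalGlobal` (§B local part, p102616 ACCEPTED), `DeRhamRankZero`
(§D.1, p104646), `PinnedFontaineDatumUndecided` (§B main + §C, p105788).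
Provers/leads may `import` those modules (namespace `…Theorems.ReciprocityUpToIrreducibility.Negative`).

## Findings (index)

* **§A — the Fontaine specification does not pin the Weil–Deligne normalisation.**  For every
  `p`-adic Hodge datum `𝔇` there is an "unramified twist" `𝔇.unrTwist c` (same `ℚ_ℓ`-structure, same
  period ring `𝔅`, relation `IsWeilDeligneOf` twisted by the unramified character `w ↦ c ^ deg w`),
  which satisfies the five structure axioms and EVERY clause of `IsFontaineDatum` that `𝔇` does
  (`isFontaineDatum_unrTwist`); for `c = -1` the two data cannot both attach the trivial
  Weil–Deligne representation to the trivial rank-one representation.  Hence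
  `exists_isFontaineDatum_not_wdTrivialClause`: under `IsFontaineDatum hℓ 𝔇` some datum with all the
  clauses violates `WDTrivialClause`.
* **§B — the crux DECIDES that clause for the ε-pinned datum.** `ReciprocityUpToIrreducibility`
  (direction (A') at `n = 1` for the trivial character `π_𝟙 = ℂ·1/⊥`: Satake `{1}` a.e. ⇒ `ρ = 1`
  by Chebotarev density; then local–global compatibility at `v ∣ ℓ`: the local component of `π_𝟙` is
  the trivial character, `rec_v` of it is `(1 ∘ artin, 0)` by `gl_one`, rank one kills the nilpotent
  part, transport along `ι` pins `r`) proves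
  `(fontainePstAdicCompletion v ℓ hv).IsWeilDeligneOf 1 trivial` (`wdTrivialClause_of_reciprocityUpToIrreducibility`);
  so does the line's `stub_pairCompatibility` (`wdTrivialClause_of_pairCompatibility`) and the summit
  `Langlands` (`wdTrivialClause_of_langlands`).
* **§C — consequence.** `fontainePstAdicCompletion v ℓ hv` is `Classical.epsilon (IsFontaineDatum _)`;
  §A + §B give `reciprocityUpToIrreducibility_separates_fontaineSpec`: under E and
  `FontaineDatumExists` some full-spec datum disagrees with the pinned one on the clause.  META (not a
  Lean statement): by the usual independence of `Classical.choice`, NO proof of E (or of `Langlands`,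
  or of `stub_pairCompatibility`) exists in the present tree — the `v ∣ ℓ` clause is formally
  undecidable until the construction `WD ∘ D_pst` lands (upgrade path of `FontaineDpst`, definition
  items D1/D2) or `IsFontaineDatum` gains a normalisation clause.  This is NOT `¬E`: E is consistent
  (true in the intended model if reciprocity holds).  WHY E RESISTS A KILL: `∃ Rec` ranges over
  genuine LLC data (n = 0 and n = 1 consistent, no cardinality gap), `Corresponds` at `v ∤ ℓ` is
  definitional and satisfiable (`IsWeilDeligneOfLadic.of_N_eq_zero`), the de Rham clause holds for
  unramified representations under every datum, and every remaining clause is either open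
  mathematics or the ε-term above.
* **§D — line `Sketch`, stub by stub** (end of file).
-/

noncomputable section

set_option linter.dupNamespace false

open scoped MatrixGroups NumberField Classical
open Field Filter IsDedekindDomain
open Literature.NumberTheory.Automorphic Literature.NumberTheory.GaloisRepresentations
open Literature.NumberTheory.PAdicHodge

namespace Summit.Langlands.Langlands.Cruxes.ReciprocityUpToIrreducibility.Disproof

/-! ## §A  Unramified twists of `p`-adic Hodge data -/

section Twist

variable {F : Type} [Field F] [ValuativeRel F] [TopologicalSpace F] [IsNonarchimedeanLocalField F]

/-- `deg` is additive (the named facts `IsFrobPow.mul/unique` are discharged in the tree). [folklore] -/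
theorem deg_mul' (w w' : WeilGroup F) :
    WeilGroup.deg (w * w') = WeilGroup.deg w + WeilGroup.deg w' :=
  WeilGroup.deg_mul IsFrobPow.mul_holds IsFrobPow.unique_holds w w'

/-- `deg 1 = 0`. [folklore] -/
theorem deg_one' : WeilGroup.deg (1 : WeilGroup F) = 0 :=
  WeilGroup.deg_one IsFrobPow.mul_holds IsFrobPow.unique_holds

/-- `deg` vanishes on inertia. [folklore] -/
theorem deg_eq_zero_of_mem_inertia' {u : WeilGroup F} (hu : u ∈ WeilGroup.inertia F) :
    WeilGroup.deg u = 0 :=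
  (WeilGroup.deg_eq_zero_iff_mem_inertia IsFrobPow.mul_holds IsFrobPow.unique_holds).2 hu

/-- There is a Weil element of degree `1` (an arithmetic Frobenius). [folklore] -/
theorem exists_deg_eq_one : ∃ w : WeilGroup F, WeilGroup.deg w = 1 :=
  WeilGroup.deg_surjective IsFrobPow.mul_holds IsFrobPow.unique_holds (exists_isFrobPow_holds F) 1

variable {C : Type*} [Field C] [CharZero C] {V : Type*} [AddCommGroup V] [Module C V]

/-- **Unramified twist of a Weil–Deligne representation** by the unramified character
`w ↦ c ^ deg w` (`c ∈ Cˣ`): same space, same `N`, `ρ'(w) = c ^ deg w • ρ(w)`. [folklore] -/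
def unrTwistWD (c : Cˣ) (r : WeilDeligneRep F C V) : WeilDeligneRep F C V where
  ρ :=
    { toFun := fun w => ((c : C) ^ WeilGroup.deg w) • r.ρ w
      map_one' := by rw [deg_one', zpow_zero, one_smul, map_one]
      map_mul' := fun w w' => by
        rw [deg_mul', zpow_add₀ c.ne_zero, map_mul, smul_mul_assoc, mul_smul_comm, smul_smul] }
  isContinuous := by
    obtain ⟨U, hU, hUo, hker⟩ := r.isContinuous
    refine ⟨U, hU, hUo, fun u hu => ?_⟩
    show ((c : C) ^ WeilGroup.deg u) • r.ρ u = 1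
    rw [deg_eq_zero_of_mem_inertia' (hU hu), zpow_zero, one_smul, hker u hu]
  N := r.N
  isNilpotent_N := r.isNilpotent_N
  conj_N := fun w => by
    show (((c : C) ^ WeilGroup.deg w) • r.ρ w) ∘ₗ r.N =
      ((IsNonarchimedeanLocalField.residueFieldCard F : C) ^ WeilGroup.deg w) •
        (r.N ∘ₗ (((c : C) ^ WeilGroup.deg w) • r.ρ w))
    rw [LinearMap.smul_comp, LinearMap.comp_smul, r.conj_N w]
    exact smul_comm _ _ _

@[simp] theorem unrTwistWD_ρ_apply (c : Cˣ) (r : WeilDeligneRep F C V) (w : WeilGroup F) :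
    (unrTwistWD c r).ρ w = ((c : C) ^ WeilGroup.deg w) • r.ρ w := rfl

@[simp] theorem unrTwistWD_N (c : Cˣ) (r : WeilDeligneRep F C V) : (unrTwistWD c r).N = r.N := rfl

variable {ℓ : ℕ} [Fact ℓ.Prime]

/-- **Unramified twist of a `p`-adic Hodge datum**: same `ℚ_ℓ`-algebra structure, same period
ring, and `IsWeilDeligneOf ρ r :⇔ r is the unramified c-twist of some r₀ attached to ρ by 𝔇`.
All five structure axioms are inherited. [folklore] -/
def unrTwist (𝔇 : PstWeilDeligneData F ℓ) (c : (PadicAlgCl ℓ)ˣ) : PstWeilDeligneData F ℓ where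
  algebra := 𝔇.algebra
  𝔅 := 𝔇.𝔅
  IsWeilDeligneOf := fun ρ r => ∃ r₀, 𝔇.IsWeilDeligneOf ρ r₀ ∧
    (∀ w, r.ρ w = ((c : PadicAlgCl ℓ) ^ WeilGroup.deg w) • r₀.ρ w) ∧ r.N = r₀.N
  exists_of_isDeRham := fun ρ hρ => by
    obtain ⟨r₀, h⟩ := 𝔇.exists_of_isDeRham ρ hρ
    exact ⟨unrTwistWD c r₀, r₀, h, fun _ => rfl, rfl⟩
  isEquivalent := fun ρ r r' hr hr' => by
    obtain ⟨r₀, h₀, hρ₀, hN₀⟩ := hr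
    obtain ⟨r₁, h₁, hρ₁, hN₁⟩ := hr'
    obtain ⟨e⟩ := 𝔇.isEquivalent ρ r₀ r₁ h₀ h₁
    have he : ∀ w, (e.toLinearEquiv : (Fin _ → PadicAlgCl ℓ) →ₗ[PadicAlgCl ℓ] _) ∘ₗ r.ρ w =
        r'.ρ w ∘ₗ (e.toLinearEquiv : (Fin _ → PadicAlgCl ℓ) →ₗ[PadicAlgCl ℓ] _) := fun w => by
      rw [hρ₀ w, hρ₁ w, LinearMap.comp_smul, LinearMap.smul_comp]
      exact congrArg _ (e.toRepEquiv.isIntertwining' w)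
    refine ⟨⟨Representation.Equiv.mk e.toLinearEquiv he, ?_⟩⟩
    show (e.toLinearEquiv : (Fin _ → PadicAlgCl ℓ) →ₗ[PadicAlgCl ℓ] _) ∘ₗ r.N =
      r'.N ∘ₗ (e.toLinearEquiv : (Fin _ → PadicAlgCl ℓ) →ₗ[PadicAlgCl ℓ] _)
    rw [hN₀, hN₁]
    exact e.comm_N
  conj := fun g ρ r hr => by
    obtain ⟨r₀, h₀, h⟩ := hr
    exact ⟨r₀, 𝔇.conj g ρ r₀ h₀, h⟩
  isDeRhamWith_of_isLocallyUnramified := 𝔇.isDeRhamWith_of_isLocallyUnramified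
  wd_of_isLocallyUnramified := fun ρ r hρ hr => by
    obtain ⟨r₀, h₀, hρ₀, hN₀⟩ := hr
    obtain ⟨hN, hunr⟩ := 𝔇.wd_of_isLocallyUnramified ρ r₀ hρ h₀
    refine ⟨hN₀.trans hN, fun u hu => ?_⟩
    rw [hρ₀ u, deg_eq_zero_of_mem_inertia' hu, zpow_zero, one_smul]
    exact hunr u hu

@[simp] theorem unrTwist_algebra (𝔇 : PstWeilDeligneData F ℓ) (c : (PadicAlgCl ℓ)ˣ) :
    (unrTwist 𝔇 c).algebra = 𝔇.algebra := rfl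

@[simp] theorem unrTwist_𝔅 (𝔇 : PstWeilDeligneData F ℓ) (c : (PadicAlgCl ℓ)ˣ) :
    (unrTwist 𝔇 c).𝔅 = 𝔇.𝔅 := rfl

theorem unrTwist_isWeilDeligneOf_iff (𝔇 : PstWeilDeligneData F ℓ) (c : (PadicAlgCl ℓ)ˣ) {n : ℕ}
    (ρ : FramedRep (absoluteGaloisGroup F) (PadicAlgCl ℓ) n)
    (r : WeilDeligneRep F (PadicAlgCl ℓ) (Fin n → PadicAlgCl ℓ)) :
    (unrTwist 𝔇 c).IsWeilDeligneOf ρ r ↔ ∃ r₀, 𝔇.IsWeilDeligneOf ρ r₀ ∧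
      (∀ w, r.ρ w = ((c : PadicAlgCl ℓ) ^ WeilGroup.deg w) • r₀.ρ w) ∧ r.N = r₀.N :=
  Iff.rfl

/-- `IsDeRhamFramed` is literally unchanged by the twist (same algebra, same `𝔅`). [folklore] -/
theorem unrTwist_isDeRhamFramed_iff (𝔇 : PstWeilDeligneData F ℓ) (c : (PadicAlgCl ℓ)ˣ) {n : ℕ}
    (ρ : FramedRep (absoluteGaloisGroup F) (PadicAlgCl ℓ) n) :
    (unrTwist 𝔇 c).IsDeRhamFramed ρ ↔ 𝔇.IsDeRhamFramed ρ :=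
  Iff.rfl

/-- **The class of crystalline representations is twist-invariant.** [folklore] -/
theorem unrTwist_isCrystallineFramed_iff (𝔇 : PstWeilDeligneData F ℓ) (c : (PadicAlgCl ℓ)ˣ)
    {n : ℕ} (ρ : FramedRep (absoluteGaloisGroup F) (PadicAlgCl ℓ) n) :
    (unrTwist 𝔇 c).IsCrystallineFramed ρ ↔ 𝔇.IsCrystallineFramed ρ := by
  constructor
  · rintro ⟨hdR, r, ⟨r₀, h₀, hρ, hN⟩, hN0, hunr⟩
    refine ⟨hdR, r₀, h₀, by rw [← hN]; exact hN0, fun u hu => ?_⟩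
    have h := hunr u hu
    rw [hρ u, deg_eq_zero_of_mem_inertia' hu, zpow_zero, one_smul] at h
    exact h
  · rintro ⟨hdR, r₀, h₀, hN0, hunr⟩
    refine ⟨hdR, unrTwistWD c r₀, ⟨r₀, h₀, fun _ => rfl, rfl⟩, hN0, fun u hu => ?_⟩
    show ((c : PadicAlgCl ℓ) ^ WeilGroup.deg u) • r₀.ρ u = 1
    rw [deg_eq_zero_of_mem_inertia' hu, zpow_zero, one_smul]
    exact hunr u hu

/-- Function-level form of `unrTwist_isCrystallineFramed_iff` (for rewriting inside types). -/
theorem unrTwist_isCrystallineFramed_eq (𝔇 : PstWeilDeligneData F ℓ) (c : (PadicAlgCl ℓ)ˣ)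
    (n : ℕ) :
    (fun ρ : FramedRep (absoluteGaloisGroup F) (PadicAlgCl ℓ) n =>
        (unrTwist 𝔇 c).IsCrystallineFramed ρ) =
      fun ρ => 𝔇.IsCrystallineFramed ρ :=
  funext fun ρ => propext (unrTwist_isCrystallineFramed_iff 𝔇 c ρ)

/-- **Every clause of Fontaine's specification transfers to the unramified twist.** (F1)–(F3)
see only the algebra structure and the period ring; (F4)–(F7) see `IsCrystallineFramed`, which is
twist-invariant. [folklore] -/
theorem isFontaineDatum_unrTwist [CharZero F] {hℓ : ValuativeRel.valuation F ℓ < 1}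
    {𝔇 : PstWeilDeligneData F ℓ} (h : IsFontaineDatum hℓ 𝔇) (c : (PadicAlgCl ℓ)ˣ) :
    IsFontaineDatum hℓ (unrTwist 𝔇 c) where
  algebra_eq := h.algebra_eq
  cyclotomicWeightNegOne := h.cyclotomicWeightNegOne
  unramifiedWeightsZero := h.unramifiedWeightsZero
  isCrystallineFramed_cyclotomic :=
    (unrTwist_isCrystallineFramed_iff 𝔇 c _).2 h.isCrystallineFramed_cyclotomic
  hasCrystallineDeformationRings := by
    intro L _ n ρbar a b hex
    obtain ⟨ρ, hred, hcr, hw⟩ := hex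
    have h5 := h.hasCrystallineDeformationRings L n ρbar a b
      ⟨ρ, hred, (unrTwist_isCrystallineFramed_iff 𝔇 c ρ).1 hcr, hw⟩
    have hpred : (fun ρ : FramedRep (absoluteGaloisGroup F) (PadicAlgCl ℓ) n =>
        (unrTwist 𝔇 c).IsCrystallineFramed ρ ∧ (unrTwist 𝔇 c).IsDeRhamWithWeightsIn a b ρ) =
        fun ρ => 𝔇.IsCrystallineFramed ρ ∧ 𝔇.IsDeRhamWithWeightsIn a b ρ :=
      funext fun ρ => propext (and_congr (unrTwist_isCrystallineFramed_iff 𝔇 c ρ) Iff.rfl)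
    unfold CrystallineDeformationRing
    rw [hpred]
    exact h5
  hasHodgeTypeCrystallineDeformationRings := by
    intro L _ hL n ρbar v hex
    obtain ⟨ρ, hred, hcr, hw⟩ := hex
    have h6 := h.hasHodgeTypeCrystallineDeformationRings L hL n ρbar v
      ⟨ρ, hred, (unrTwist_isCrystallineFramed_iff 𝔇 c ρ).1 hcr, hw⟩
    have hpred : (fun ρ : FramedRep (absoluteGaloisGroup F) (PadicAlgCl ℓ) n =>
        (unrTwist 𝔇 c).IsCrystallineFramed ρ ∧ (unrTwist 𝔇 c).HasHodgeType v ρ) =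
        fun ρ => 𝔇.IsCrystallineFramed ρ ∧ 𝔇.HasHodgeType v ρ :=
      funext fun ρ => propext (and_congr (unrTwist_isCrystallineFramed_iff 𝔇 c ρ) Iff.rfl)
    unfold CrystallineDeformationRing
    rw [hpred]
    exact h6
  crystallineGenericFibreRegular := by
    intro L _ hL n ρbar v
    have h7 := h.crystallineGenericFibreRegular L hL n ρbar v
    have hpred : (fun ρ : FramedRep (absoluteGaloisGroup F) (PadicAlgCl ℓ) n =>
        (unrTwist 𝔇 c).IsCrystallineFramed ρ ∧ (unrTwist 𝔇 c).HasHodgeType v ρ) =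
        fun ρ => 𝔇.IsCrystallineFramed ρ ∧ 𝔇.HasHodgeType v ρ :=
      funext fun ρ => propext (and_congr (unrTwist_isCrystallineFramed_iff 𝔇 c ρ) Iff.rfl)
    unfold CrystallineDeformationRing
    rw [hpred]
    exact h7

/-- **The clause the crux decides and the specification does not**: the datum attaches the TRIVIAL
Weil–Deligne representation to the trivial rank-one representation of `Γ_F`. True for Fontaine's
genuine `WD ∘ D_pst` (`D_cris(ℚ_ℓ) = F₀`, `φ = σ`), but not a consequence of `IsFontaineDatum`. -/
def WDTrivialClause (𝔇 : PstWeilDeligneData F ℓ) : Prop :=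
  𝔇.IsWeilDeligneOf (1 : FramedRep (absoluteGaloisGroup F) (PadicAlgCl ℓ) 1)
    (WeilDeligneRep.trivial (PadicAlgCl ℓ) (Fin 1 → PadicAlgCl ℓ))

/-- A datum and its `(-1)`-twist cannot both satisfy `WDTrivialClause`: the two Weil–Deligne
representations attached to `1` would be isomorphic (`isEquivalent`), forcing `(-1) ^ deg w = 1`
at an arithmetic Frobenius `w` (`deg w = 1`), i.e. `-1 = 1` in `ℚ̄_ℓ`. [folklore] -/
theorem not_wdTrivialClause_and_unrTwist (𝔇 : PstWeilDeligneData F ℓ) :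
    ¬ (WDTrivialClause 𝔇 ∧ WDTrivialClause (unrTwist 𝔇 (-1))) := by
  rintro ⟨h1, r₀, h₀, hρ, -⟩
  obtain ⟨e⟩ := 𝔇.isEquivalent _ _ _ h1 h₀
  obtain ⟨w, hw⟩ := exists_deg_eq_one (F := F)
  -- `r₀.ρ w = id`: transport through `e : trivial ≃ r₀`
  have hid : ∀ y, r₀.ρ w y = y := by
    intro y
    obtain ⟨x, rfl⟩ := e.toLinearEquiv.surjective y
    have h := congrArg (fun f => f x) (e.toRepEquiv.isIntertwining' w)
    simp only [LinearMap.coe_comp, Function.comp_apply, WeilDeligneRep.trivial,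
      WeilDeligneRep.ofRep_ρ, Representation.trivial_apply] at h
    exact h.symm
  -- the twist relation at `w`: `id = (-1) • id`
  have h2 := congrArg (fun f => f (fun _ => (1 : PadicAlgCl ℓ))) (hρ w)
  simp only [WeilDeligneRep.trivial, WeilDeligneRep.ofRep_ρ, Representation.trivial_apply,
    LinearMap.smul_apply, hid, hw, zpow_one, Units.val_neg, Units.val_one, neg_smul, one_smul] at h2
  have h3 := congrFun h2 0
  simp only [Pi.neg_apply] at h3
  have h4 : (2 : PadicAlgCl ℓ) = 0 := by linear_combination h3
  exact two_ne_zero h4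

/-- **Non-pinning, relative form.** If some datum satisfies Fontaine's clauses then some datum
satisfies them and violates `WDTrivialClause`. [folklore] -/
theorem exists_isFontaineDatum_not_wdTrivialClause [CharZero F]
    {hℓ : ValuativeRel.valuation F ℓ < 1} {𝔇 : PstWeilDeligneData F ℓ} (h : IsFontaineDatum hℓ 𝔇) :
    ∃ 𝔇' : PstWeilDeligneData F ℓ, IsFontaineDatum hℓ 𝔇' ∧ ¬ WDTrivialClause 𝔇' := by
  by_cases h1 : WDTrivialClause 𝔇
  · exact ⟨unrTwist 𝔇 (-1), isFontaineDatum_unrTwist h _,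
      fun h2 => not_wdTrivialClause_and_unrTwist 𝔇 ⟨h1, h2⟩⟩
  · exact ⟨𝔇, h, h1⟩

/-- **Non-pinning, absolute form.** The TYPE `PstWeilDeligneData F ℓ` always contains a datum
violating `WDTrivialClause` (twist the truncated model if necessary) — relevant because
`fontainePst` is `Classical.epsilon`, which returns an arbitrary inhabitant when the
specification is empty. [folklore] -/
theorem exists_not_wdTrivialClause [CharZero F] (hℓ : ValuativeRel.valuation F ℓ < 1) :
    ∃ 𝔇 : PstWeilDeligneData F ℓ, ¬ WDTrivialClause 𝔇 := by
  letI := LocalField.padicAlgebra F ℓ hℓ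
  by_cases h1 : WDTrivialClause (unramifiedPstWeilDeligneData F ℓ)
  · exact ⟨unrTwist _ (-1), fun h2 => not_wdTrivialClause_and_unrTwist _ ⟨h1, h2⟩⟩
  · exact ⟨_, h1⟩

/-- Under `FontaineDatumExists`, at every local field some datum with ALL of Fontaine's clauses
violates the clause; so no argument from `FontaineDatumExists` (or from any property shared by all
data with the clauses) can establish `WDTrivialClause (fontainePst F ℓ hℓ)`. [folklore] -/
theorem exists_isFontaineDatum_not_wdTrivialClause_of_fontaineDatumExists [CharZero F]
    (hF : FontaineDatumExists) (hℓ : ValuativeRel.valuation F ℓ < 1) :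
    ∃ 𝔇' : PstWeilDeligneData F ℓ, IsFontaineDatum hℓ 𝔇' ∧ ¬ WDTrivialClause 𝔇' := by
  obtain ⟨𝔇, h⟩ := hF F ℓ hℓ
  exact exists_isFontaineDatum_not_wdTrivialClause h

end Twist

/-! ## §B  The crux (and the line's `stub_pairCompatibility`) DECIDE `WDTrivialClause` of the
ε-pinned datum `fontainePstAdicCompletion v ℓ hv` -/

section Pins

open Summit.Langlands
open Summit.Langlands.Langlands.Theses.IrreducibilityBySelfDuality (ReciprocityUpToIrreducibility)

/-- Two Weil–Deligne representations with the same `ρ` and the same `N` are equal. [folklore] -/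
theorem wd_ext {F : Type} [Field F] [ValuativeRel F] [TopologicalSpace F] [IsNonarchimedeanLocalField F]
    {C : Type*} [Field C] [CharZero C] {V : Type*} [AddCommGroup V] [Module C V]
    {r r' : WeilDeligneRep F C V} (hρ : r.ρ = r'.ρ) (hN : r.N = r'.N) : r = r' := by
  cases r; cases r'; cases hρ; cases hN; rfl

/-- A nilpotent endomorphism of a line is zero. [folklore] -/
theorem eq_zero_of_isNilpotent_fin_one {C : Type*} [Field C] (n : Module.End C (Fin 1 → C))
    (hn : IsNilpotent n) : n = 0 := by
  set a : C := n (fun _ => 1) 0 with ha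
  have hscalar : n = a • (1 : Module.End C (Fin 1 → C)) := by
    apply LinearMap.ext
    intro v
    funext i
    have hv : v = v 0 • (fun _ : Fin 1 => (1 : C)) := by
      funext j
      rw [Subsingleton.elim j 0, Pi.smul_apply, smul_eq_mul, mul_one]
    rw [Subsingleton.elim i 0, hv, map_smul]
    simp [ha, mul_comm]
  obtain ⟨k, hk⟩ := hn
  have hak : a ^ k = 0 := by
    have h := congrArg (fun f : Module.End C (Fin 1 → C) => f (fun _ => 1) 0) hk
    simp only [hscalar, smul_pow, one_pow, LinearMap.smul_apply, Module.End.one_apply,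
      LinearMap.zero_apply, Pi.smul_apply, Pi.zero_apply, smul_eq_mul, mul_one] at h
    exact h
  have ha0 : a = 0 := IsNilpotent.eq_zero ⟨k, hak⟩
  rw [hscalar, ha0, zero_smul]

variable {K : Type} [Field K] [NumberField K] {ℓ : ℕ} [Fact ℓ.Prime]

/-- **Local unpacking at `v ∣ ℓ`.** For the trivial automorphic character `π = ℂ·1/⊥` of
`GL₁(𝔸_K)` (`W = ℂ · (1 ∘ det)`, `W' = ⊥`), local–global compatibility at `v` with ANY `ρ` forces the
pinned datum to attach the TRIVIAL Weil–Deligne representation to `ρ|_{Γ_{K_v}}`: the local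
component of `π` at `v` is the trivial character (irreducibility of `π_v` + `W = ℂ·1`), `rec_v` of it
is `(1 ∘ artin, 0)` (`gl_one`), its Frobenius-semisimple class pins `rℂ` (rank one: nilpotents
vanish), and transport along `ι` pins `r`. [folklore] -/
theorem isWeilDeligneOf_trivial_of_localGlobalCompatibleAt
    {hcpt : isCompact_glFiniteIntegralLevel 1 K}
    {π : AutomorphicRepData (AutomorphyDatum.gl 1 K hcpt)}
    (hW : π.W = Submodule.span ℂ {fun g : (AdelicGroupData.gl 1 K).Adelic =>
      (detTwist 1 (1 : HeckeCharacter K) g : ℂ)})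
    (hW' : π.W' = ⊥) (Rec : ReciprocityData K) (ι : PadicAlgCl ℓ ≃+* ℂ)
    (ρ : FramedGaloisRep K (PadicAlgCl ℓ) 1) (v : HeightOneSpectrum (𝓞 K))
    (h : LocalGlobalCompatibleAt Rec ι π ρ v) (hv : ((ℓ : ℕ) : 𝓞 K) ∈ v.asIdeal) :
    (fontainePstAdicCompletion v ℓ hv).IsWeilDeligneOf
      (ρ.toLocal v) (WeilDeligneRep.trivial (PadicAlgCl ℓ) (Fin 1 → PadicAlgCl ℓ)) := by
  obtain ⟨πv, r, rℂ, hloc, -, hpst, htr, hcls⟩ := h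
  -- (1) the local component is the trivial character
  have htriv : ∀ (g : GL (Fin 1) (v.adicCompletion K)) (x : πv.V), πv.ρ g x = x := by
    obtain ⟨f, hfW, hfW', hf⟩ := hloc
    have hd1 : ∀ h : (AdelicGroupData.gl 1 K).Adelic,
        ((detTwist 1 (1 : HeckeCharacter K) h : ℂˣ) : ℂ) = 1 := fun h => by
      rw [detTwist_apply, HeckeCharacter.one_apply, Units.val_one]
    have hfix : ∀ (g : GL (Fin 1) (v.adicCompletion K)) (x : πv.V),
        rightTranslation (AdelicGroupData.gl 1 K) (GLn.ofLocal 1 K v g) (f x) = f x := by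
      intro g x
      have hx : f x ∈ π.W := hfW (LinearMap.mem_range_self f x)
      rw [hW, Submodule.mem_span_singleton] at hx
      obtain ⟨a, ha⟩ := hx
      rw [← ha, map_smul, rightTranslation_detTwist_glOne, hd1, one_smul]
    have hinv : ∀ g x, f (πv.ρ g x) = f x := by
      intro g x
      have h0 := hf g x
      rw [hW', Submodule.mem_bot, hfix, sub_eq_zero] at h0
      exact h0
    let Φ : Representation.IntertwiningMap πv.ρ
        (Representation.trivial ℂ (GL (Fin 1) (v.adicCompletion K))
          ((AdelicGroupData.gl 1 K).Adelic → ℂ)) :=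
      ⟨f, fun g => LinearMap.ext fun x => by
        simp only [LinearMap.coe_comp, Function.comp_apply, Representation.trivial_apply, hinv g x]⟩
    have hΦ : ∀ y, Φ y = f y := fun _ => rfl
    rcases Representation.IsIrreducible.injective_or_eq_zero Φ with hinj | hzero
    · intro g x
      exact hinj (show Φ (πv.ρ g x) = Φ x by rw [hΦ, hΦ, hinv g x])
    · exfalso
      apply hfW'
      have hf0 : f = 0 := by
        apply LinearMap.ext
        intro y
        rw [← hΦ, hzero]
        rfl
      rw [hf0, LinearMap.range_zero]
      exact bot_le
  -- (2) local Langlands for `GL₁`: `rec(π_v) ≅ (1 ∘ artin, N = 0)`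
  set L := Rec.llc v with hL
  have hact : ∀ (g : GL (Fin 1) (v.adicCompletion K)) (w : πv.V),
      πv.ρ g w = (((1 : QuasiChar (v.adicCompletion K)) (Matrix.GeneralLinearGroup.det g) : ℂˣ) :
        ℂ) • w := by
    intro g w
    rw [htriv g w]
    simp
  have hgl := L.isLocalLanglands.gl_one 1 πv hact
  -- (3) the Frobenius-semisimple class of `rℂ` is `rec(π_v)`
  obtain ⟨r', hF, hq⟩ := hcls
  have hr'c : r'.IsEquivalent ((L.recGL 1 (IrrClass.mk πv)).out).1 :=
    Quotient.exact (hq.trans (Quotient.out_eq _).symm)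
  obtain ⟨e⟩ := hr'c.trans hgl
  have hT : ∀ w, (WeilDeligneRep.ofQuasiChar L.hns L.artin (1 : QuasiChar (v.adicCompletion K))).ρ w
      = LinearMap.id := fun w => LinearMap.ext fun z => by simp
  have heinj : Function.Injective e.toLinearMap := e.toLinearEquiv.injective
  have hr'ρ : ∀ w, r'.ρ w = LinearMap.id := by
    intro w
    apply LinearMap.ext
    intro x
    apply heinj
    have h1 := congrArg (fun f => f x) (e.toRepEquiv.isIntertwining' w)
    simpa [hT] using h1
  have hr'N : r'.N = 0 := by
    apply LinearMap.ext
    intro x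
    apply heinj
    have h1 := congrArg (fun f => f x) e.comm_N
    simpa using h1
  -- (4) rank one: `rℂ` itself is trivial
  obtain ⟨hNN, -, hss⟩ := hF
  have hrℂN : rℂ.N = 0 := hNN ▸ hr'N
  have hrℂρ : ∀ w, rℂ.ρ w = LinearMap.id := by
    intro w
    obtain ⟨-, nw, hnil, -, hdec⟩ := hss w
    rw [hdec, hr'ρ w, eq_zero_of_isNilpotent_fin_one nw hnil, add_zero]
  -- (5) transport along `ι`: `r` is trivial
  have hι0 : (ι : PadicAlgCl ℓ →+* ℂ) 0 = 0 := map_zero _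
  have hι1 : (ι : PadicAlgCl ℓ →+* ℂ) 1 = 1 := map_one _
  have hrρ : ∀ w, r.ρ w = LinearMap.id := by
    intro w
    have h1 := htr.1 w
    rw [hrℂρ w, LinearMap.toMatrix'_id] at h1
    have h2 : LinearMap.toMatrix' (r.ρ w) = 1 := by
      apply Matrix.map_injective (RingHom.injective (ι : PadicAlgCl ℓ →+* ℂ))
      dsimp only
      rw [← h1, Matrix.map_one _ hι0 hι1]
    exact LinearMap.toMatrix'.injective (h2.trans LinearMap.toMatrix'_id.symm)
  have hrN : r.N = 0 := by
    have h1 := htr.2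
    rw [hrℂN, map_zero] at h1
    have h2 : LinearMap.toMatrix' r.N = 0 := by
      apply Matrix.map_injective (RingHom.injective (ι : PadicAlgCl ℓ →+* ℂ))
      dsimp only
      rw [← h1, Matrix.map_zero _ hι0]
    exact LinearMap.toMatrix'.injective (h2.trans (map_zero _).symm)
  have hr : r = WeilDeligneRep.trivial (PadicAlgCl ℓ) (Fin 1 → PadicAlgCl ℓ) := by
    refine wd_ext (MonoidHom.ext fun w => ?_) ?_
    · rw [hrρ w]; rfl
    · rw [hrN]; rfl
  rw [← hr]
  exact hpst hv

/-- **The trivial automorphic character of `GL₁(𝔸_K)` as a cuspidal L-algebraic datum with Satake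
parameter `{1}` almost everywhere** (`π_𝟙 = ℂ·1/⊥`; Borel–Jacquet 4.6, rank-one dictionary in
tree). [folklore] -/
theorem exists_trivial_cuspidal (hcpt : isCompact_glFiniteIntegralLevel 1 K) :
    ∃ π : CuspidalAutomorphicRepData 1 K hcpt,
      π.1.W = Submodule.span ℂ {fun g : (AdelicGroupData.gl 1 K).Adelic =>
        (detTwist 1 (1 : HeckeCharacter K) g : ℂ)} ∧
      π.1.W' = ⊥ ∧ π.1.IsLAlgebraic ∧
      ∀ᶠ v : HeightOneSpectrum (𝓞 K) in cofinite, π.1.HasSatakeParamAt v {1} := by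
  classical
  obtain ⟨π₀, hW, hW'⟩ := exists_automorphicRepData_detTwist_glOne hcpt (1 : HeckeCharacter K)
  have hcusp : π₀.W ≤ cuspFormsGL 1 K hcpt := by
    rw [hW, Submodule.span_le]
    rintro _ rfl
    exact IsCuspFormGL.mem_cuspFormsGL
      ⟨isAutomorphicForm_detTwist_glOne hcpt 1, fun k hk hk1 => absurd hk1 (by omega)⟩
  set π : CuspidalAutomorphicRepData 1 K hcpt := ⟨π₀, hcusp⟩ with hπdef
  have hχ : ∀ (g : (AdelicGroupData.gl 1 K).Adelic), ∀ φ ∈ π.1.W,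
      rightTranslation (AdelicGroupData.gl 1 K) g φ -
        (((1 : HeckeCharacter K) (Matrix.GeneralLinearGroup.det g) : ℂˣ) : ℂ) • φ ∈ π.1.W' := by
    intro g φ hφ
    change φ ∈ π₀.W at hφ
    rw [hW, Submodule.mem_span_singleton] at hφ
    obtain ⟨c, rfl⟩ := hφ
    rw [map_smul, rightTranslation_detTwist_glOne, detTwist_apply, smul_comm, sub_self]
    exact π.1.W'.zero_mem
  refine ⟨π, hW, hW', ?_, ?_⟩
  · have hωfin : (1 : HeckeCharacter K).IsFiniteOrder := IsOfFinOrder.one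
    obtain ⟨p, q, hpq⟩ :=
      ((1 : HeckeCharacter K).isAlgebraic_iff_exists_hasInfinityType).mp hωfin.isAlgebraic
    obtain ⟨T, hT, hTa⟩ :=
      π.1.exists_hasInfinityType_of_hasInfinityType_heckeCharacter_glOne hχ hpq
    refine ⟨T, hT, fun σ w hw => ?_⟩
    have ha : w.a = -((HeckeCharacter.embExponent p q σ : ℤ) : ℂ) := by
      have hmem : w.a ∈ (T σ).map ArchWeight.a := Multiset.mem_map_of_mem _ hw
      rw [hTa σ] at hmem
      exact Multiset.mem_singleton.mp hmem
    obtain ⟨m, hm⟩ := w.exists_int_sub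
    refine ⟨-HeckeCharacter.embExponent p q σ, -HeckeCharacter.embExponent p q σ - m, ?_, ?_⟩
    · rw [ha]
      push_cast
      ring
    · have hb : w.b = w.a - m := by rw [← hm]; ring
      rw [hb, ha]
      push_cast
      ring
  · obtain ⟨𝔪, h𝔪, hω𝔪⟩ := HeckeCharacter.exists_level_glOne (1 : HeckeCharacter K)
    filter_upwards [(Ideal.finite_factors h𝔪).compl_mem_cofinite] with v hv
    have hsat := AutomorphicRepData.hasSatakeParamAt_detTwist_glOne hcpt hW hW' h𝔪 hω𝔪 v hv
      (HeckeCharacter.valued_uniformizer (K := K) v)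
    simpa using hsat

/-- **Rigidity of the trivial character (Chebotarev density).** A rank-one `ρ` which is
Satake–Frobenius compatible a.e. with an automorphic datum of Satake parameter `{1}` a.e. IS the
trivial representation. [folklore] -/
theorem eq_one_of_satakeFrobCompatible_trivial {hcpt : isCompact_glFiniteIntegralLevel 1 K}
    {π : CuspidalAutomorphicRepData 1 K hcpt}
    (hsat : ∀ᶠ v : HeightOneSpectrum (𝓞 K) in cofinite, π.1.HasSatakeParamAt v {1})
    (ι : PadicAlgCl ℓ ≃+* ℂ) (ρ : FramedGaloisRep K (PadicAlgCl ℓ) 1)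
    (hρ : ∀ᶠ v : HeightOneSpectrum (𝓞 K) in cofinite, SatakeFrobCompatibleAt ι π.1 ρ v) :
    ρ = 1 := by
  classical
  have hev : ∀ᶠ v : HeightOneSpectrum (𝓞 K) in cofinite, ∀ 𝔓 ∈ v.primesAbove,
      ∀ Φ : absoluteGaloisGroup K, IsArithFrobAt (𝓞 K) Φ 𝔓 →
        (((ρ Φ : GL (Fin 1) (PadicAlgCl ℓ)) : Matrix (Fin 1) (Fin 1) (PadicAlgCl ℓ)) 0 0) = 1 := by
    filter_upwards [hsat, hρ] with v hv1 hv
    obtain ⟨α, hα, -, hcp⟩ := hv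
    obtain rfl : α = {1} := AutomorphicRepData.hasSatakeParamAt_unique_holds π.1 hα hv1
    rw [arithFrobPolyOfSatake_one, Multiset.map_singleton, Multiset.prod_singleton, inv_one,
      map_one] at hcp
    exact (FramedGaloisRep.hasFrobCharpolyAt_iff_of_rank_one ρ v 1).mp hcp
  set S : Set (HeightOneSpectrum (𝓞 K)) := {v | ¬ ∀ 𝔓 ∈ v.primesAbove,
      ∀ Φ : absoluteGaloisGroup K, IsArithFrobAt (𝓞 K) Φ 𝔓 →
        (((ρ Φ : GL (Fin 1) (PadicAlgCl ℓ)) : Matrix (Fin 1) (Fin 1) (PadicAlgCl ℓ)) 0 0) = 1}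
    with hS
  have hSfin : S.Finite := Filter.eventually_cofinite.1 hev
  have hdense := absoluteGaloisGroup.frobenius_dense chebotarev_artinRep_holds K S hSfin
  have htrace : ∀ σ, FramedRep.trace ρ σ =
      (((ρ σ : GL (Fin 1) (PadicAlgCl ℓ)) : Matrix (Fin 1) (Fin 1) (PadicAlgCl ℓ)) 0 0) := by
    intro σ
    simp [FramedRep.trace, Matrix.trace_fin_one]
  have hclosed : IsClosed {σ : absoluteGaloisGroup K | FramedRep.trace ρ σ = 1} :=
    isClosed_eq (FramedRep.continuous_trace ρ) continuous_const
  have hsub : {σ : absoluteGaloisGroup K | ∃ v ∉ S, ∃ 𝔓 ∈ v.primesAbove, IsArithFrobAt (𝓞 K) σ 𝔓} ⊆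
      {σ | FramedRep.trace ρ σ = 1} := by
    rintro σ ⟨v, hv, 𝔓, h𝔓, hσ⟩
    simp only [hS, Set.mem_setOf_eq, not_not] at hv
    show FramedRep.trace ρ σ = 1
    rw [htrace]
    exact hv 𝔓 h𝔓 σ hσ
  have hall : ∀ σ, FramedRep.trace ρ σ = 1 := fun σ =>
    hclosed.closure_subset_iff.2 hsub (by rw [hdense.closure_eq]; exact Set.mem_univ σ)
  refine DFunLike.ext _ _ fun σ => ?_
  ext i j
  rw [Subsingleton.elim i 0, Subsingleton.elim j 0, ← htrace, hall]
  rfl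

/-- `(1 : Γ_K → GL₁).toLocal v = 1`. [folklore] -/
theorem toLocal_one (v : HeightOneSpectrum (𝓞 K)) :
    (1 : FramedGaloisRep K (PadicAlgCl ℓ) 1).toLocal v = 1 :=
  DFunLike.ext _ _ fun _ => rfl

/-- **§B, crux form.** `ReciprocityUpToIrreducibility` DECIDES the Weil–Deligne normalisation of
the ε-pinned datum: at every place `v ∣ ℓ` of every number field the datum
`fontainePstAdicCompletion v ℓ hv` attaches the trivial Weil–Deligne representation to the trivial
rank-one representation. By §A this is NOT a consequence of `IsFontaineDatum`, so the crux (hence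
the summit `Langlands`) is unprovable from hypotheses shared by all Fontaine-spec data — in
particular from `FontaineDatumExists`. [folklore] -/
theorem wdTrivialClause_of_reciprocityUpToIrreducibility (hE : ReciprocityUpToIrreducibility)
    (K : Type) [Field K] [NumberField K] (ℓ : ℕ) [Fact ℓ.Prime]
    (v : HeightOneSpectrum (𝓞 K)) (hv : ((ℓ : ℕ) : 𝓞 K) ∈ v.asIdeal) :
    (fontainePstAdicCompletion v ℓ hv).IsWeilDeligneOf
      (1 : FramedRep (absoluteGaloisGroup (v.adicCompletion K)) (PadicAlgCl ℓ) 1)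
      (WeilDeligneRep.trivial (PadicAlgCl ℓ) (Fin 1 → PadicAlgCl ℓ)) := by
  obtain ⟨Rec, hRec⟩ := hE K
  obtain ⟨hA, -⟩ := hRec 1 one_pos (isCompact_glFiniteIntegralLevel_holds 1 K)
  obtain ⟨π, hW, hW', hL, hsat⟩ := exists_trivial_cuspidal (isCompact_glFiniteIntegralLevel_holds 1 K)
  obtain ⟨ι⟩ := PadicAlgCl.nonempty_ringEquiv_complex ℓ
  obtain ⟨ρ, -, hcorr⟩ := hA π hL ℓ ι
  obtain rfl : ρ = 1 := eq_one_of_satakeFrobCompatible_trivial hsat ι ρ hcorr.1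
  have h := isWeilDeligneOf_trivial_of_localGlobalCompatibleAt hW hW' Rec ι 1 v (hcorr.2 v) hv
  rwa [toLocal_one] at h

/-- **§B, line form (`stub_pairCompatibility` of line `Sketch` decides the same clause).** The
stub's `∃ Rec` asserts local–global compatibility at every `v` for IRREDUCIBLE pinned-geometric `ρ`
a.e.-compatible with an L-algebraic cuspidal `π`; the pair (`π_𝟙`, `ρ = 1`) qualifies (rank one is
irreducible; `1` is unramified hence de Rham for every datum; Satake `{1}` a.e.). [folklore] -/
theorem wdTrivialClause_of_pairCompatibility
    (hPC : ∀ (K : Type) [Field K] [NumberField K], ∃ Rec : ReciprocityData K,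
      ∀ (n : ℕ) (hcpt : isCompact_glFiniteIntegralLevel n K), 0 < n →
        ∀ (π : CuspidalAutomorphicRepData n K hcpt), π.1.IsLAlgebraic →
          ∀ (ℓ : ℕ) [Fact ℓ.Prime] (ι : PadicAlgCl ℓ ≃+* ℂ) (ρ : FramedGaloisRep K (PadicAlgCl ℓ) n),
            ρ.toGaloisRep.IsIrreducible →
            ((∀ᶠ v : HeightOneSpectrum (𝓞 K) in cofinite, ρ.IsUnramifiedAt v) ∧
              ∀ (v : HeightOneSpectrum (𝓞 K)) (hv : ((ℓ : ℕ) : 𝓞 K) ∈ v.asIdeal),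
                (fontainePstAdicCompletion v ℓ hv).IsDeRhamFramed (ρ.toLocal v)) →
              (∀ᶠ v : HeightOneSpectrum (𝓞 K) in cofinite, SatakeFrobCompatibleAt ι π.1 ρ v) →
                ∀ v : HeightOneSpectrum (𝓞 K), LocalGlobalCompatibleAt Rec ι π.1 ρ v)
    (K : Type) [Field K] [NumberField K] (ℓ : ℕ) [Fact ℓ.Prime]
    (v : HeightOneSpectrum (𝓞 K)) (hv : ((ℓ : ℕ) : 𝓞 K) ∈ v.asIdeal) :
    (fontainePstAdicCompletion v ℓ hv).IsWeilDeligneOf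
      (1 : FramedRep (absoluteGaloisGroup (v.adicCompletion K)) (PadicAlgCl ℓ) 1)
      (WeilDeligneRep.trivial (PadicAlgCl ℓ) (Fin 1 → PadicAlgCl ℓ)) := by
  obtain ⟨Rec, hRec⟩ := hPC K
  obtain ⟨π, hW, hW', hL, hsat⟩ := exists_trivial_cuspidal (isCompact_glFiniteIntegralLevel_holds 1 K)
  obtain ⟨ι⟩ := PadicAlgCl.nonempty_ringEquiv_complex ℓ
  have hirr := Summit.Langlands.Langlands.Theorems.IrreducibleOffSector.isIrreducible_of_rank_one
    (K := K) (1 : FramedGaloisRep K (PadicAlgCl ℓ) 1)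
  have hunr : ∀ w : HeightOneSpectrum (𝓞 K), (1 : FramedGaloisRep K (PadicAlgCl ℓ) 1).IsUnramifiedAt w :=
    fun _ _ _ _ _ => rfl
  have hgeo : (∀ᶠ w : HeightOneSpectrum (𝓞 K) in cofinite,
      (1 : FramedGaloisRep K (PadicAlgCl ℓ) 1).IsUnramifiedAt w) ∧
      ∀ (w : HeightOneSpectrum (𝓞 K)) (hw : ((ℓ : ℕ) : 𝓞 K) ∈ w.asIdeal),
        (fontainePstAdicCompletion w ℓ hw).IsDeRhamFramed
          ((1 : FramedGaloisRep K (PadicAlgCl ℓ) 1).toLocal w) :=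
    ⟨Filter.Eventually.of_forall hunr, fun w hw =>
      (fontainePstAdicCompletion w ℓ hw).isDeRhamFramed_of_isLocallyUnramified fun _ _ => rfl⟩
  have hcompat : ∀ᶠ w : HeightOneSpectrum (𝓞 K) in cofinite,
      SatakeFrobCompatibleAt ι π.1 (1 : FramedGaloisRep K (PadicAlgCl ℓ) 1) w := by
    filter_upwards [hsat] with w hw1
    refine ⟨{1}, hw1, hunr w, ?_⟩
    rw [arithFrobPolyOfSatake_one, Multiset.map_singleton, Multiset.prod_singleton, inv_one, map_one,
      FramedGaloisRep.hasFrobCharpolyAt_iff_of_rank_one]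
    intro _ _ _ _
    rfl
  have h := hRec 1 _ one_pos π hL ℓ ι 1 hirr hgeo hcompat v
  have h' := isWeilDeligneOf_trivial_of_localGlobalCompatibleAt hW hW' Rec ι 1 v h hv
  rwa [toLocal_one] at h'

end Pins

/-! ## §C  Consequences: the crux / the summit SEPARATE the ε-pinned datum from a full-spec datum -/

section Consequences

open Summit.Langlands
open Summit.Langlands.Langlands.Theses.IrreducibilityBySelfDuality (ReciprocityUpToIrreducibility)
open Summit.Langlands.Langlands.Theorems.ReciprocityUpToIrreducibility
  (langlands_iff_reciprocityUpToIrreducibility_and_irreducible)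

/-- **The obstruction, in one line.** Under the crux AND Fontaine's existence theorem, at every
`v ∣ ℓ` there is a datum with ALL of Fontaine's characterising clauses which disagrees with the
pinned datum `fontainePstAdicCompletion v ℓ hv = Classical.epsilon (IsFontaineDatum _)` on
`WDTrivialClause`.  Since nothing beyond `IsFontaineDatum` is provable about an `ε`-term, the crux is
not derivable in the present tree from `FontaineDatumExists` together with any facts that hold for
every Fontaine-spec datum: the `v ∣ ℓ` local–global clause needs either the CONSTRUCTION of
`WD ∘ D_pst` (definition items D1/D2, upgrade path of `FontaineDpst`) or a normalisation clause added
to `IsFontaineDatum`. [folklore] -/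
theorem reciprocityUpToIrreducibility_separates_fontaineSpec (hE : ReciprocityUpToIrreducibility)
    (hF : FontaineDatumExists) (K : Type) [Field K] [NumberField K] (ℓ : ℕ) [Fact ℓ.Prime]
    (v : HeightOneSpectrum (𝓞 K)) (hv : ((ℓ : ℕ) : 𝓞 K) ∈ v.asIdeal) :
    ∃ 𝔇' : PstWeilDeligneData (v.adicCompletion K) ℓ,
      (haveI := LocalField.charZero_adicCompletion v
       IsFontaineDatum (LocalField.valuation_adicCompletion_natCast_lt_one v ℓ hv) 𝔇') ∧
      WDTrivialClause (fontainePstAdicCompletion v ℓ hv) ∧ ¬ WDTrivialClause 𝔇' := by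
  haveI := LocalField.charZero_adicCompletion v
  obtain ⟨𝔇', h', hn⟩ := exists_isFontaineDatum_not_wdTrivialClause
    (isFontaineDatum_fontainePstAdicCompletion hF v ℓ hv)
  exact ⟨𝔇', h', wdTrivialClause_of_reciprocityUpToIrreducibility hE K ℓ v hv, hn⟩

/-- **Summit form.** `Langlands` itself decides `WDTrivialClause` of the pinned datum (through
`Langlands → ReciprocityUpToIrreducibility`, p78886); so the SUMMIT STATEMENT, as pinned on
2026-08-16 (D-0018 L2), is not closable before the upgrade path of `FontaineDpst` is taken.
[folklore] -/
theorem wdTrivialClause_of_langlands (hL : _root_.Langlands) (K : Type) [Field K] [NumberField K]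
    (ℓ : ℕ) [Fact ℓ.Prime] (v : HeightOneSpectrum (𝓞 K)) (hv : ((ℓ : ℕ) : 𝓞 K) ∈ v.asIdeal) :
    WDTrivialClause (fontainePstAdicCompletion v ℓ hv) :=
  wdTrivialClause_of_reciprocityUpToIrreducibility
    (langlands_iff_reciprocityUpToIrreducibility_and_irreducible.mp hL).1 K ℓ v hv

/-- The absolute form at the summit's places: whatever `Classical.epsilon` returns, the TYPE of the
pinned datum has inhabitants violating the clause. [folklore] -/
theorem exists_not_wdTrivialClause_adicCompletion (K : Type) [Field K] [NumberField K] (ℓ : ℕ)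
    [Fact ℓ.Prime] (v : HeightOneSpectrum (𝓞 K)) (hv : ((ℓ : ℕ) : 𝓞 K) ∈ v.asIdeal) :
    ∃ 𝔇 : PstWeilDeligneData (v.adicCompletion K) ℓ, ¬ WDTrivialClause 𝔇 := by
  haveI := LocalField.charZero_adicCompletion v
  exact exists_not_wdTrivialClause (LocalField.valuation_adicCompletion_natCast_lt_one v ℓ hv)

end Consequences

/-! ## §D  Line `Sketch` (lead prover-line-stmt-Langlands-14328-0): stub-by-stub

* `stub_pairCompatibility` — **decides the unpinned clause** (`wdTrivialClause_of_pairCompatibility`,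
  §B): as stated (LocalGlobalCompatibleAt at EVERY `v`, including `v ∣ ℓ`, for irreducible
  pinned-geometric `ρ`) it is not derivable from any Fontaine-spec-invariant hypotheses.  Suggested
  reshape for the lead: split into `pairCompatibility_away` (only `v ∤ ℓ`: the Grothendieck–Deligne
  relation `IsWeilDeligneOfLadic` is a DEFINITION, so this half is meaningful — Varma-type content)
  and `pairCompatibility_above` (`v ∣ ℓ`), the latter explicitly BLOCKED on the definition items
  D1/D2 of `FontaineDpst` (construction of `B_dR(K_v)` and `WD ∘ D_pst`) or on a normalisation clause.
* `stub_weakExistence`, `stub_weakAutomorphy` — open (BG 3.2.2 / FM–Langlands); their `n = 1`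
  Satake content is landed (`exists_satakeFrobCompatible_rankOne`,
  `exists_cuspidal_satakeFrobCompatible_rankOne_of_isOpen_ker`).  NOTE the same ε-pinning hazard in
  `stub_weakExistence`: its conclusion asks `IsDeRhamFramed` for the PINNED datum, provable only for
  representations de Rham for EVERY Fontaine-spec datum (unramified ones are, by the structure axiom;
  whether e.g. Lubin–Tate characters are is not settled by (F1)–(F7) as far as this seat can see —
  no proof either way here).
* `stub_deRhamBlocks` — TRUE for every datum: `PeriodRingData` carries Fontaine's regularity axioms
  (domain, `(Frac B)^Γ = B^Γ`, `Γ`-stable `ℚ_ℓ`-lines are units), so Exp. III Prop. 1.5.2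
  (sub/quotient stability of `B`-admissible representations) applies verbatim; the model over a finite
  `E/ℚ_ℓ` of the sub-block is obtained by enlarging `E` with the entries of the conjugating matrix.
  Degenerate edges `m = 0` / `p = 0` are harmless: a rank-0 representation is de Rham for EVERY datum
  (`isDeRhamFramed_of_rank_zero`, §D.1, kernel-checked).  No attack.
* `stub_geometricConstituents` — Jordan–Hölder + D1; true.  No attack.
* `stub_isobaricRigidity` — `HasSatakeParamAt` pins `card α = n` (`HasSatakeParamAt.card_eq`), so
  `α = Σ βᵢ` forces `n = Σ mᵢ` with every `mᵢ < n` (`k ≥ 2`, `mᵢ > 0`): no empty-multiset or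
  rank-mismatch junk; the statement is Jacquet–Shalika II Thm. 4.4 at unramified places, conditional
  on the two JS named facts it takes as hypotheses.  No attack.
* `stub_jsPole` — a Literature named fact (Arthur–Clozel Ch. 3 (2.3)); not attacked.

Joint sufficiency: `ReciprocityUpToIrreducibility_of` is kernel-checked glue; no gap smuggled. -/


/-! ### §D.1  Tightness at the degenerate edge of `stub_deRhamBlocks`: rank zero is de Rham for every datum -/

section RankZero

open TensorProduct

variable {F : Type} [Field F] [ValuativeRel F] [TopologicalSpace F] [IsNonarchimedeanLocalField F]
  {ℓ : ℕ} [Fact ℓ.Prime]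

/-- **Rank-zero representations are de Rham for EVERY `p`-adic Hodge datum** (model over `ℚ_ℓ`
itself; both dimensions in Fontaine's admissibility condition vanish).  So the edges `m = 0` / `p = 0`
of `stub_deRhamBlocks` (a block of size zero) carry no junk. [folklore] -/
theorem isDeRhamFramed_of_rank_zero (𝔇 : PstWeilDeligneData F ℓ)
    (ρ : FramedRep (absoluteGaloisGroup F) (PadicAlgCl ℓ) 0) : 𝔇.IsDeRhamFramed ρ := by
  letI := 𝔇.algebra
  refine ⟨⊥, inferInstance, 1, ⟨1, DFunLike.ext _ _ fun σ => Subsingleton.elim _ _⟩, ?_⟩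
  show Module.finrank F _ = Module.finrank ℚ_[ℓ] (Fin 0 → (⊥ : IntermediateField ℚ_[ℓ] (PadicAlgCl ℓ)))
  have h0 : Module.finrank ℚ_[ℓ] (Fin 0 → (⊥ : IntermediateField ℚ_[ℓ] (PadicAlgCl ℓ))) = 0 :=
    Module.finrank_zero_of_subsingleton
  haveI : Subsingleton (𝔇.𝔅.B ⊗[ℚ_[ℓ]] (Fin 0 → (⊥ : IntermediateField ℚ_[ℓ] (PadicAlgCl ℓ)))) := by
    refine ⟨fun x y => ?_⟩
    have hx : ∀ z : 𝔇.𝔅.B ⊗[ℚ_[ℓ]] (Fin 0 → (⊥ : IntermediateField ℚ_[ℓ] (PadicAlgCl ℓ))), z = 0 :=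
      fun z => z.induction_on rfl (fun b m => by rw [Subsingleton.elim m 0, tmul_zero])
        (fun x y hx hy => by rw [hx, hy, add_zero])
    rw [hx x, hx y]
  rw [h0]
  exact Module.finrank_zero_of_subsingleton

/-- The `m = 0` edge of `stub_deRhamBlocks`, first conjunct, holds outright. [folklore] -/
theorem deRhamBlocks_rank_zero_block (𝔇 : PstWeilDeligneData F ℓ) {p n : ℕ}
    (T : FramedRep (absoluteGaloisGroup F) (PadicAlgCl ℓ) n)
    (A : FramedRep (absoluteGaloisGroup F) (PadicAlgCl ℓ) 0)
    (_D : FramedRep (absoluteGaloisGroup F) (PadicAlgCl ℓ) p) (_hT : 𝔇.IsDeRhamFramed T) :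
    𝔇.IsDeRhamFramed A :=
  isDeRhamFramed_of_rank_zero 𝔇 A

end RankZero

end Summit.Langlands.Langlands.Cruxes.ReciprocityUpToIrreducibility.Disproof

end
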